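import Summits.BirchSwinnertonDyer.BirchSwinnertonDyer.Theorems.ByReductionTypeAtTwoFineSelmerConjAAtTwoAdditivePotGoodAscentStampsA
import Summits.BirchSwinnertonDyer.BirchSwinnertonDyer.Theorems.ByReductionTypeAtTwoAdditivePotMultConjATwoOddPowerCertificate
import HarnessLib

/-!
# C4″ `AdditivePotMultOverKAtTwo` (item stmt-BirchSwinnertonDyer-22618), the (I1M′) input of the upper half on the `Δ < 0` rows:
# KERNEL STAMPS, part ZC — Iwasawa's `μ₂ = 0` (ZERO hypotheses) for the `2`-torsion cubic fields `d = -2856` and UNCONDITIONAL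
# statement (A) at `2` for the C4″ census curves 325584bk1

Cell `bsd-2adic`, rung K4, seat `bsd-2adic-k4-w3` GEN 11 (explicit unit of director-bsd g16 (309)(7); `--supports stmt-BirchSwinnertonDyer-22618`).
HONEST FRAMING (D-0036/D-0054/D-0152): THEOREMS ONLY (no definition, no named fact, no `sorry`). FIELD PART (unconditional kernel arithmetic about an
explicit cubic field `ℚ(θ)`; generator = eng-2's polredabs cubic when its index `[𝓞 : ℤ[θ]]` is odd, else an odd-index second generator):
`irreducible_cubic_<d>`, `odd_classNumber_of_root_<d>` (norm certificate below the Minkowski bound; k4-w1's `odd_classNumber_of_cubeCertificate`),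
**`classicalMu_two_cubicField_<d>`** = `μ = 0` (growth form) along EVERY cyclotomic `ℤ₂`-extension of `ℚ(θ)` from `e₀ = 0` (odd `h`), `e₁ = 0` (k4-w1's
Chevalley door at `2`, `layerOneBit_of_chevalleyCert`: a unit with `2`-adic image `≡ ±3 (mod 8)` is not a norm from `ℚ(θ, √2)`; ≤ 2 primes above `2`),
`n₀ = 0` (odd cubic discriminant `…_of_odd_cubic_discr`, or `2 = 𝔭𝔮²` with an even-index certificate `…_of_evenIndexCertificate`) and Fukuda 1994 Thm. 1 (1)
(`_holds`). These fields have TWO primes above `2` (the `2`-division cubic of a potentially multiplicative curve has a `ℚ₂`-root). ROW PART: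
`conjA_two_<L>'` = Coates–Sujatha's statement (A) at `p = 2` for the census cubic model of the Cremona class (a-invariants of addL2x GEN 13's
`nst_census-j313647.tsv`), PROVED OUTRIGHT: field identification `ℚ(β) = ℚ(θ)` + cruxlead-19573-w2's door
`TotallyComplexMu.conjA_two_cubicModel_of_classicalMu_of_discr_neg` (kernel Lim 3.5@2 + `ℓ = 2` ascent). Certificates (norm witnesses, fundamental units by a
relation sieve, Hensel data, even-index elements) found by the seat's exact-arithmetic tools (`work/tools/`) and CHECKED HERE by the kernel; eng-2's
census CERT-ADD-POTMULT-FUKUDA269-E2 agrees (`μ₂ = λ₂ = 0`, bnfcertify). Statement (A) is NOT BSD: BSD₂ for these curves is not proved; C4″ / (I1M′) stay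
research-open; nothing booked; no row of 22618 changes tier (pen RC-490 (4)). Pattern/toolkit: k4-w1 GEN 5–8 (`…MuTwoKernelRows{A,B}`, `…AscentStampsA`).

References: [CoatesSujatha2005] Conj. A, Thm. 3.4; [Iwasawa1973MuInvariants] Thm. 2/3; [Fukuda1994] Thm. 1 (1); [Lang1990] Ch. 13 §4 Lemma 4.1;
[Washington1997] §13.1; [Marcus1977] Ch. 5 Thm. 35–37; [Cohen1993] §6.3; [Lim2017FineSelmer] §3; cell files `eng2/fukuda269/{TABLE,LAYERS}-…-E2-v1.tsv`.
-/

set_option autoImplicit false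
-- sibling precedent (`…MuTwoKernelRowsA.lean`): the directory name repeats the summit name
set_option linter.dupNamespace false

noncomputable section
open scoped Classical IntermediateField NumberField Real nonZeroDivisors
namespace Summit.BirchSwinnertonDyer.BirchSwinnertonDyer.Theorems.AddKatoTwo
open WeierstrassCurve Field Polynomial IsDedekindDomain NumberField Matrix Literature.NumberTheory.EllipticCurves
  Literature.NumberTheory.GaloisRepresentations
  Literature.NumberTheory.IwasawaTheory
  Summit.BirchSwinnertonDyer.BirchSwinnertonDyer.Theorems.SteinbergFibreAtTwo
  Summit.BirchSwinnertonDyer.BirchSwinnertonDyer.Theorems.AlignedTransportAtTwoTorsionPointField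
  Summit.BirchSwinnertonDyer.BirchSwinnertonDyer.Theses.ByReductionTypeAtTwo

/-! ## The cubic field of discriminant `-2856` — odd-index generator `X³ + (-2)X² + (-13)X + (-28)` (`[𝓞 : ℤ[θ]] = 3`; eng-2's polredabs cubic `X³ + (-1)X² + (9)X + (-21)` has
index `2`; `θ = (7/2) + (0)·θ₀ + (1/2)·θ₀²`); C4″ rows 325584bk1 -/

/-- `X³ + (-2)X² + (-13)X + (-28)` is irreducible over `ℚ` (no root mod `5`). -/
theorem irreducible_cubic_d2856n : Irreducible (Cubic.toPoly ⟨1, ((-2 : ℤ) : ℚ), ((-13 : ℤ) : ℚ), ((-28 : ℤ) : ℚ)⟩) :=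
  haveI : Fact (Nat.Prime 5) := ⟨by norm_num⟩
  irreducible_cubic_of_no_root_zmod 5 (by decide)

/-- `X³ + (-1)X² + (9)X + (-21)` (a second generator of the same field) is irreducible over `ℚ` (no root mod `5`). -/
theorem irreducible_cubic_d2856n_aux : Irreducible (Cubic.toPoly ⟨1, ((-1 : ℤ) : ℚ), ((9 : ℤ) : ℚ), ((-21 : ℤ) : ℚ)⟩) :=
  haveI : Fact (Nat.Prime 5) := ⟨by norm_num⟩
  irreducible_cubic_of_no_root_zmod 5 (by decide)

section Certd2856n

variable (K : Type) [Field K] [NumberField K]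

/-- **`h` is ODD for every cubic number field whose integers contain a root `θ` of `X³ + (-2)X² + (-13)X + (-28)`** (`|disc| = 25704 = 3²·2856`,
`|d_K| ≤ 2856` by the index-`3` element `θ₀`, `M_K < 16`): a norm certificate — for every prime `ℓ < 16` and every root `a` of the cubic mod `ℓ` a generator
`(x + yθ + zθ²)/m ∈ 𝓞 K` of the ideal `I ∋ ℓ, θ − a` of norm `ℓ`, or of its CUBE with Bézout data (6 witnesses; 6 cube witnesses; 1 with `m > 1` outside `ℤ[θ]`; the prime(s) dividing the index `3` through the
second generator `θ₀` of `𝓞 K` (`exists_intElem_of_scaled_cubic`), 2 witnesses). Found by the seat's relation sieve (Hermite normal form over the `S`-unit lattice) and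
CHECKED HERE by the kernel (`pow_three_eq_span_of_cert`). eng-2's PARI value (bnfcertify): `h = 7`. KERNEL. [cite: Marcus1977, Ch. 5 Thm. 35–37 and Cor. 2] [cite: Cohen1993, §6.3] -/
theorem odd_classNumber_of_root_d2856n (h3 : Module.finrank ℚ K = 3) (b : 𝓞 K)
    (hb : b ^ 3 + (-2 : ℤ) * b ^ 2 + (-13 : ℤ) * b + (-28 : ℤ) = 0) : Odd (NumberField.classNumber K) := by
  have hirr := irreducible_cubic_d2856n
  -- second generator `b2 = ((-7) + (-3)θ + (1)θ²)/3`, a root of `X³ + (-1)X² + (9)X + (-21)` (index prime to `3`)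
  obtain ⟨b2, hb2m, hb2⟩ := exists_intElem_of_scaled_cubic K b (-7) (-3) (1) (m := 3) (by norm_num) (-1) (9) (-21)
    (by push_cast; linear_combination (((58 : ℤ) : 𝓞 K) + ((2 : ℤ) : 𝓞 K) * b + ((-7 : ℤ) : 𝓞 K) * b ^ 2 + ((1 : ℤ) : 𝓞 K) * b ^ 3 + ((0 : ℤ) : 𝓞 K) * b ^ 4) * hb)
  have hd : |NumberField.discr K| ≤ (2856 : ℕ) :=
    abs_discr_le_of_sq_mul_le K (k := 3) (by norm_num)
      (sq_mul_abs_discr_le_abs_cubic_discr K h3 b hirr hb (by norm_num) (-7) (-3) (1) ⟨b2, hb2m⟩ (by norm_num))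
      (by simp only [Cubic.discr]; norm_num)
  have hirr2 := irreducible_cubic_d2856n_aux
  refine odd_classNumber_of_powCertificate K h3 (B := 16)
    (minkowskiBound_lt_of_sqrt_le K h3 hd (s := 53.45)
      ((Real.sqrt_le_sqrt (by norm_num : ((2856 : ℕ) : ℝ) ≤ (53.45 : ℝ) ^ 2)).trans (Real.sqrt_sq (by norm_num)).le)
      (by norm_num)) (k := 7) ⟨3, by norm_num⟩ ?_
  intro ℓ hℓB hℓ J hJ
  interval_cases ℓ <;> norm_num at hℓ
  · -- `ℓ = 2`: roots [0, 1]
    refine pow_eq_span_of_cert K h3 b hirr hb (by norm_num) (fun a ha hdvd => ?_) hJ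
    interval_cases a <;> norm_num at hdvd
    · exact Or.inr ⟨(16), (0), (-1), 3, by norm_num, by norm_num,
        (exists_intElem_of_scaled_cubic K b (16) (0) (-1) (m := 3) (by norm_num) (-6) (-15) (128)
          (by push_cast; linear_combination (((-28 : ℤ) : 𝓞 K) + ((13 : ℤ) : 𝓞 K) * b + ((-2 : ℤ) : 𝓞 K) * b ^ 2 + ((-1 : ℤ) : 𝓞 K) * b ^ 3 + ((0 : ℤ) : 𝓞 K) * b ^ 4) * hb)).imp (fun _ h => h.1), by norm_num,
        ⟨1, (0), (1), (0), (-14), (1), (-1), by push_cast; linear_combination (((-1 : ℤ) : 𝓞 K) + ((0 : ℤ) : 𝓞 K) * b) * hb⟩, ⟨1, by norm_num⟩⟩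
    · exact Or.inr ⟨(-3), (6), (-1), 1, by norm_num, by norm_num,
        ⟨_, by rw [Nat.cast_one, one_mul]⟩, by norm_num,
        ⟨2, (1), (0), (0), (-2), (4), (-1), by push_cast; linear_combination (((0 : ℤ) : 𝓞 K) + ((0 : ℤ) : 𝓞 K) * b) * hb⟩, ⟨0, by norm_num⟩⟩
  · -- `ℓ = 3` divides the index of `ℤ[θ]`: second generator `b2`, roots [0, 1]
    refine pow_eq_span_of_cert K h3 b2 hirr2 hb2 (by norm_num) (fun a ha hdvd => ?_) hJ
    interval_cases a <;> norm_num at hdvd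
    · exact Or.inr ⟨(12), (-6), (1), 1, by norm_num, by norm_num,
        ⟨_, by rw [Nat.cast_one, one_mul]⟩, by norm_num,
        ⟨2, (1), (0), (0), (4), (-2), (0), by push_cast; linear_combination (((0 : ℤ) : 𝓞 K) + ((0 : ℤ) : 𝓞 K) * b2) * hb2⟩, ⟨0, by norm_num⟩⟩
    · exact Or.inr ⟨(2), (-5), (0), 1, by norm_num, by norm_num,
        ⟨_, by rw [Nat.cast_one, one_mul]⟩, by norm_num,
        ⟨1, (1), (0), (0), (1), (-2), (0), by push_cast; linear_combination (((0 : ℤ) : 𝓞 K) + ((0 : ℤ) : 𝓞 K) * b2) * hb2⟩, ⟨0, by norm_num⟩⟩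
  · -- `ℓ = 5`: roots []
    refine pow_eq_span_of_cert K h3 b hirr hb (by norm_num) (fun a ha hdvd => ?_) hJ
    interval_cases a <;> norm_num at hdvd
  · -- `ℓ = 7`: roots [0, 1]
    refine pow_eq_span_of_cert K h3 b hirr hb (by norm_num) (fun a ha hdvd => ?_) hJ
    interval_cases a <;> norm_num at hdvd
    · exact Or.inr ⟨(7), (12), (12), 1, by norm_num, by norm_num,
        ⟨_, by rw [Nat.cast_one, one_mul]⟩, by norm_num,
        ⟨1, (4), (1), (0), (52), (30), (12), by push_cast; linear_combination (((12 : ℤ) : 𝓞 K) + ((0 : ℤ) : 𝓞 K) * b) * hb⟩, ⟨0, by norm_num⟩⟩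
    · exact Or.inr ⟨(151), (34), (-10), 1, by norm_num, by norm_num,
        ⟨_, by rw [Nat.cast_one, one_mul]⟩, by norm_num,
        ⟨2, (2), (0), (0), (43), (10), (-3), by push_cast; linear_combination (((0 : ℤ) : 𝓞 K) + ((0 : ℤ) : 𝓞 K) * b) * hb⟩, ⟨0, by norm_num⟩⟩
  · -- `ℓ = 11`: roots []
    refine pow_eq_span_of_cert K h3 b hirr hb (by norm_num) (fun a ha hdvd => ?_) hJ
    interval_cases a <;> norm_num at hdvd
  · -- `ℓ = 13`: roots []
    refine pow_eq_span_of_cert K h3 b hirr hb (by norm_num) (fun a ha hdvd => ?_) hJ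
    interval_cases a <;> norm_num at hdvd

end Certd2856n

/-- **Iwasawa's `μ₂ = 0` for the cubic field of discriminant `-2856`** (`ℚ(θ)`, `θ³ + (-2)θ² + (-13)θ + (-28) = 0`, index `3`; TWO primes above `2`,
`2 = 𝔭𝔮²`; `h` odd), KERNEL — every cyclotomic `ℤ₂`-extension of `ℚ(θ)` has `μ = 0` (growth form; indeed `e_n = 0` for all `n`).
Chevalley's door at `2` (k4-w1 `layerOneBit_of_chevalleyCert`): the fundamental unit `ε = ((-5) + (-3)θ + (-1)θ²)/3` (regulator ≈ 2.82;
`ε³ + (17)ε² + (5)ε + (1) = 0`) has `ε ≡ 5 (mod 8)` under `θ ↦ z₂ ≡ 4` (`8 ∣ g(4)`, `g'(4)` odd), so `(ε, 2)_𝔭 = −1`: a non-norm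
from `ℚ(θ, √2)`, whence `e₁ = 0`; `≤ 2` primes above `2` by `4 ∤ g(2)`, `4 ∤ g(1)`; `e₀ = 0` by `odd_classNumber_of_root_d2856n`; `n₀ = 0` by an even-index certificate in `ℤ[θ]` (`classicalMuVanishes_two_adjoin_of_evenIndexCertificate`); Fukuda 1994 Thm. 1 (1) (`_holds`).
The (I1M′) input of GEN 9's door for the C4″ rows 325584bk1. [cite: Fukuda1994, Thm. 1 (1), p. 264] [cite: Lang1990, Ch. 13 §4, Lemma 4.1]
[cite: Washington1997, §13.1] [cite: Greenberg2001IwasawaPastPresent, §4 (Iwasawa's μ-conjecture)] -/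
theorem classicalMu_two_cubicField_d2856n {θ : AlgebraicClosure ℚ} (hθ : aeval θ (Cubic.toPoly ⟨1, ((-2 : ℤ) : ℚ), ((-13 : ℤ) : ℚ), ((-28 : ℤ) : ℚ)⟩) = 0) :
    haveI : FiniteDimensional ℚ (IntermediateField.adjoin ℚ {θ}) :=
      IntermediateField.adjoin.finiteDimensional ((AlgebraicClosure.isAlgebraic ℚ).isAlgebraic θ).isIntegral
    haveI : NumberField (IntermediateField.adjoin ℚ {θ}) := NumberField.mk
    ∀ κL : ZpExtension (IntermediateField.adjoin ℚ {θ}) 2, κL.IsCyclotomic → ClassicalMuVanishes κL := by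
  intro κL hκL
  have hθ' : θ ^ 3 + (-2 : AlgebraicClosure ℚ) * θ ^ 2 + (-13 : AlgebraicClosure ℚ) * θ + (-28 : AlgebraicClosure ℚ) = 0 := by
    have := hθ
    simp only [Cubic.toPoly, map_one, one_mul, aeval_add, aeval_mul, aeval_C, aeval_X_pow, aeval_X,
      eq_ratCast, Rat.cast_intCast] at this
    push_cast at this
    linear_combination this
  have he : aeval (algebraMap ℚ (AlgebraicClosure ℚ) (((-5 : ℤ) : ℚ) / ((3 : ℤ) : ℚ)) +
      algebraMap ℚ (AlgebraicClosure ℚ) (((-3 : ℤ) : ℚ) / ((3 : ℤ) : ℚ)) * θ +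
      algebraMap ℚ (AlgebraicClosure ℚ) (((-1 : ℤ) : ℚ) / ((3 : ℤ) : ℚ)) * θ ^ 2)
      (Cubic.toPoly ⟨1, ((17 : ℤ) : ℚ), ((5 : ℤ) : ℚ), ((1 : ℤ) : ℚ)⟩) = 0 := by
    simp only [Cubic.toPoly, map_one, one_mul, aeval_add, aeval_mul, aeval_C, aeval_X_pow, aeval_X, eq_ratCast,
      Rat.cast_intCast, Rat.cast_div]
    push_cast
    field_simp
    linear_combination ((-34 : AlgebraicClosure ℚ) + (-26 : AlgebraicClosure ℚ) * θ + (-11 : AlgebraicClosure ℚ) * θ ^ 2 + (-1 : AlgebraicClosure ℚ) * θ ^ 3) * hθ'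
  have hh := not_two_dvd_card_classGroup_adjoin_of_forall_cubicField_odd irreducible_cubic_d2856n (odd_classNumber_of_root_d2856n) hθ
  have h1 := layerOneBit_of_chevalleyCert irreducible_cubic_d2856n hθ hh ⟨1, by norm_num⟩ ⟨0, by norm_num⟩
      (-5) (-3) (-1) (3) (17) (5) (1) (by norm_num) he (4) (3) (by norm_num) (by norm_num) (by decide) (by decide)
  have hirr := irreducible_cubic_d2856n
  haveI : FiniteDimensional ℚ (IntermediateField.adjoin ℚ {θ}) :=
    IntermediateField.adjoin.finiteDimensional ((AlgebraicClosure.isAlgebraic ℚ).isAlgebraic θ).isIntegral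
  haveI : NumberField (IntermediateField.adjoin ℚ {θ}) := NumberField.mk
  obtain ⟨B, -, hB⟩ := exists_ringOfIntegers_cubic_root (p := -2) (q := -13) (r := -28) hθ
  have h3 := finrank_adjoin_eq_three_of_irreducible hirr hθ
  refine classicalMuVanishes_two_adjoin_of_evenIndexCertificate (p := -2) (q := -13) (r := -28) hirr hθ
    (((0 : ℤ) : 𝓞 (IntermediateField.adjoin ℚ {θ})) + ((-1 : ℤ) : 𝓞 (IntermediateField.adjoin ℚ {θ})) * B + ((-1 : ℤ) : 𝓞 (IntermediateField.adjoin ℚ {θ})) * B ^ 2) (((0 : ℤ) : 𝓞 (IntermediateField.adjoin ℚ {θ})) + ((0 : ℤ) : 𝓞 (IntermediateField.adjoin ℚ {θ})) * B + ((-1 : ℤ) : 𝓞 (IntermediateField.adjoin ℚ {θ})) * B ^ 2) (((0 : ℤ) : 𝓞 (IntermediateField.adjoin ℚ {θ})) + ((-7 : ℤ) : 𝓞 (IntermediateField.adjoin ℚ {θ})) * B + ((-3 : ℤ) : 𝓞 (IntermediateField.adjoin ℚ {θ})) * B ^ 2) (((840 : ℤ) : 𝓞 (IntermediateField.adjoin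 ℚ {θ})) + ((516 : ℤ) : 𝓞 (IntermediateField.adjoin ℚ {θ})) * B + ((143 : ℤ) : 𝓞 (IntermediateField.adjoin ℚ {θ})) * B ^ 2) ?_ ?_ ?_
    hh κL hκL (h1 κL hκL)
  · push_cast; linear_combination (((0 : ℤ) : 𝓞 (IntermediateField.adjoin ℚ {θ})) + ((-1 : ℤ) : 𝓞 (IntermediateField.adjoin ℚ {θ})) * B + ((0 : ℤ) : 𝓞 (IntermediateField.adjoin ℚ {θ})) * B ^ 2) * hB
  · push_cast; linear_combination (((60 : ℤ) : 𝓞 (IntermediateField.adjoin ℚ {θ})) + ((9 : ℤ) : 𝓞 (IntermediateField.adjoin ℚ {θ})) * B + ((0 : ℤ) : 𝓞 (IntermediateField.adjoin ℚ {θ})) * B ^ 2) * hB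
  · have hz : (2 : 𝓞 (IntermediateField.adjoin ℚ {θ})) - (((840 : ℤ) : 𝓞 (IntermediateField.adjoin ℚ {θ})) + ((516 : ℤ) : 𝓞 (IntermediateField.adjoin ℚ {θ})) * B + ((143 : ℤ) : 𝓞 (IntermediateField.adjoin ℚ {θ})) * B ^ 2) ^ 3 =
        ((-46407881070 : ℤ) : 𝓞 (IntermediateField.adjoin ℚ {θ})) + (-30169354968 : ℤ) * B + (-8920377267 : ℤ) * B ^ 2 := by
      push_cast; linear_combination (((-1636256324 : ℤ) : 𝓞 (IntermediateField.adjoin ℚ {θ})) + ((-278776927 : ℤ) : 𝓞 (IntermediateField.adjoin ℚ {θ})) * B + ((-37503466 : ℤ) : 𝓞 (IntermediateField.adjoin ℚ {θ})) * B ^ 2 + ((-2924207 : ℤ) : 𝓞 (IntermediateField.adjoin ℚ {θ})) * B ^ 3 + ((0 : ℤ) : 𝓞 (IntermediateField.adjoin ℚ {θ})) * B ^ 4) * hB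
    rw [hz]
    exact not_eight_dvd_norm_coords _ h3 B hirr hB (-46407881070) (-30169354968) (-8920377267) (N := -33663185851707546538878)
      (by simp only [Matrix.one_fin_three, Matrix.det_fin_three, Matrix.add_apply, Matrix.smul_apply, sq, Matrix.mul_apply,
        Fin.sum_univ_three, Matrix.of_apply, Matrix.cons_val', Matrix.cons_val_zero, Matrix.cons_val_one, Matrix.cons_val_two,
        Matrix.head_cons, Matrix.tail_cons, Matrix.empty_val', Matrix.cons_val_fin_one, smul_eq_mul]; norm_num) (by norm_num)

/-! ### Row `325584bk1` (cubic field `d = -2856`) -/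

/-- The census cubic model of the C4″ row `325584bk1` (`y² = x³ + (0)x² + (-29993320803)x + (-1999332134566814)`, addL2x GEN 13 `nst_census` a-invariants) is an elliptic curve. -/
theorem isElliptic_325584bk1' : (⟨0, ((0 : ℤ) : ℚ), 0, ((-29993320803 : ℤ) : ℚ), ((-1999332134566814 : ℤ) : ℚ)⟩ : WeierstrassCurve ℚ).IsElliptic :=
  isElliptic_cubicModel _ _ _ (by simp only [Cubic.discr]; norm_num)

/-- **UNCONDITIONAL (A)₂ for the C4″ census curve `325584bk1` — ZERO hypotheses, ZERO named facts** (additive potentially multiplicative at `2`,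
irreducible `E[2]`, `Δ < 0`; `2`-torsion cubic field `ℚ(θ)`, `θ³ + (-2)θ² + (-13)θ + (-28) = 0`, `d = -25704`, `p q^2, F_q=Q2(sqrt6)`, `h` odd). Coates–Sujatha's
statement (A) at `p = 2` for the cubic model `y² = x³ + (0)x² + (-29993320803)x + (-1999332134566814)`: for every cyclotomic `ℤ₂`-extension of `ℚ` the dual fine Selmer group
over `ℚ_∞` is finitely generated over `ℤ₂` (`∃ γ D` currency). KERNEL: `classicalMu_two_cubicField_d2856n` above (μ₂(ℚ(θ)_cyc) = 0 for the field of `X³ + (-2)X² + (-13)X + (-28)`) ⟹ cruxlead-19573-w2's `ℓ = 2` ascent to the totally complex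
`ℚ(E[2]) = ℚ(θ, √d)` and kernel Lim 3.5@2 (`TotallyComplexMu.conjA_two_cubicModel_of_classicalMu_of_discr_neg`); the root `β = x(T)` of the curve's cubic is
`-70186 + (19374)θ + (5727)θ²` and `ℚ(β) = ℚ(θ)`. This discharges the (I1M′) input of this row (GEN 9 `hAnaMI_negDisc_of_cubicFieldMu`) in the kernel;
it is statement (A), NOT BSD: BSD₂ for `325584bk1` is NOT proved by this. [cite: CoatesSujatha2005, Conj. A and Thm. 3.4]
[cite: Iwasawa1973MuInvariants, Thm. 2 and Thm. 3] [cite: Fukuda1994, Thm. 1 (1), p. 264] [cite: Lang1990, Ch. 13 §4, Lemma 4.1] -/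
theorem conjA_two_325584bk1' (κ : ZpExtension ℚ 2) (hκ : κ.IsCyclotomic) :
    haveI := isElliptic_325584bk1'
    ∃ (γ : absoluteGaloisGroup ℚ) (D : (⟨0, ((0 : ℤ) : ℚ), 0, ((-29993320803 : ℤ) : ℚ), ((-1999332134566814 : ℤ) : ℚ)⟩ : WeierstrassCurve ℚ).FineSelmerDualData κ γ),
      Module.Finite ℤ_[2] (RestrictScalars ℤ_[2] (IwasawaAlgebra 2) D.X) := by
  haveI := isElliptic_325584bk1'
  obtain ⟨θ, hθ⟩ : ∃ θ : AlgebraicClosure ℚ, aeval θ (Cubic.toPoly ⟨1, ((-2 : ℤ) : ℚ), ((-13 : ℤ) : ℚ), ((-28 : ℤ) : ℚ)⟩) = 0 :=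
    IsAlgClosed.exists_aeval_eq_zero _ _ (by rw [Cubic.degree_of_a_ne_zero one_ne_zero]; norm_num)
  have hθ' : θ ^ 3 + (-2 : AlgebraicClosure ℚ) * θ ^ 2 + (-13 : AlgebraicClosure ℚ) * θ + (-28 : AlgebraicClosure ℚ) = 0 := by
    have := hθ
    simp only [Cubic.toPoly, map_one, one_mul, aeval_add, aeval_mul, aeval_C, aeval_X_pow, aeval_X,
      eq_ratCast, Rat.cast_intCast] at this
    push_cast at this
    linear_combination this
  set β : AlgebraicClosure ℚ := algebraMap ℚ (AlgebraicClosure ℚ) (-70186 : ℚ) +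
      algebraMap ℚ (AlgebraicClosure ℚ) (19374 : ℚ) * θ + algebraMap ℚ (AlgebraicClosure ℚ) (5727 : ℚ) * θ ^ 2 with hβdef
  have hβ : aeval β (Cubic.toPoly ⟨1, ((0 : ℤ) : ℚ), ((-29993320803 : ℤ) : ℚ), ((-1999332134566814 : ℤ) : ℚ)⟩) = 0 := by
    simp only [Cubic.toPoly, map_one, one_mul, aeval_add, aeval_mul, aeval_C, aeval_X_pow, aeval_X, eq_ratCast,
      Rat.cast_intCast]
    rw [hβdef]
    simp only [eq_ratCast]
    push_cast
    linear_combination ((8570085438654 : AlgebraicClosure ℚ) + (6548792102361 : AlgebraicClosure ℚ) * θ + (2281990453704 : AlgebraicClosure ℚ) * θ ^ 2 + (187837175583 : AlgebraicClosure ℚ) * θ ^ 3) * hθ'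
  have hadj : IntermediateField.adjoin ℚ {β} = IntermediateField.adjoin ℚ {θ} := by
    apply le_antisymm
    · rw [IntermediateField.adjoin_simple_le_iff, hβdef]
      have hθmem := IntermediateField.mem_adjoin_simple_self ℚ θ
      exact add_mem (add_mem (algebraMap_mem _ _) (mul_mem (algebraMap_mem _ _) hθmem))
        (mul_mem (algebraMap_mem _ _) (pow_mem hθmem 2))
    · rw [IntermediateField.adjoin_simple_le_iff]
      have hθeq : θ = algebraMap ℚ (AlgebraicClosure ℚ) (19086691163413/1412038656 : ℚ) +
          algebraMap ℚ (AlgebraicClosure ℚ) (190945339/2824077312 : ℚ) * β +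
          algebraMap ℚ (AlgebraicClosure ℚ) (-1909/2824077312 : ℚ) * β ^ 2 := by
        rw [hβdef]; simp only [eq_ratCast]; push_cast
        linear_combination (((10163899709 : AlgebraicClosure ℚ) / 52297728) + ((6956932429 : AlgebraicClosure ℚ) / 313786368) * θ) * hθ'
      rw [hθeq]
      have hβmem := IntermediateField.mem_adjoin_simple_self ℚ β
      exact add_mem (add_mem (algebraMap_mem _ _) (mul_mem (algebraMap_mem _ _) hβmem))
        (mul_mem (algebraMap_mem _ _) (pow_mem hβmem 2))
  have h3 : Module.finrank ℚ (IntermediateField.adjoin ℚ {β}) = 3 := by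
    rw [hadj]; exact finrank_adjoin_eq_three_of_irreducible irreducible_cubic_d2856n hθ
  exact TotallyComplexMu.conjA_two_cubicModel_of_classicalMu_of_discr_neg (0) (-29993320803) (-1999332134566814)
    (irreducible_cubic_of_finrank_adjoin_eq_three hβ h3) (by simp only [Cubic.discr]; norm_num) hβ
    (by rw [hadj]; exact classicalMu_two_cubicField_d2856n hθ) κ hκ
end Summit.BirchSwinnertonDyer.BirchSwinnertonDyer.Theorems.AddKatoTwo

end
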